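import Summits.BirchSwinnertonDyer.BirchSwinnertonDyer.Theorems.EisensteinPrimesX2LambdaCountAtPair
import Summits.BirchSwinnertonDyer.Rank1Residual.Iwasawa.UnitCoefficientFromRiemannSum
import HarnessLib

/-!
# Route `EisensteinPrimes`, line `mudescent`, crux 3 `MazurMCOnCellB`: the per-pair chain FROM THE
# INSTRUMENT DATUM — one certified Riemann sum of plus modular symbols ⇒ the analytic inputs of stubs
# 3 + 4 at the étale end ⇒ Mazur's main conjecture at the pair (helper; closes nothing)

Seat `bsd-eis-lam-a` g3 (PROGRAMME PART 1b, ACCEL-LIST (4); items stmt-BirchSwinnertonDyer-19033 /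
-19035). Sequel of `EisensteinPrimesX2AnalyticLambdaCertificate` (p485207) and
`EisensteinPrimesX2LambdaCountAtPair` (p486992), composed with iw-1's
`Iwasawa.unitCoeffAt_of_riemannSumUnitCertAt` (the census engines' datum `RiemannSumUnitCertAt W p n`:
per newform `f` of `W` and `ϖ` with `ϖ·Ω_E = Ω⁺_f`, a plus-symbol bound `C`, a level `n₀`, the EXACT
finite Riemann sums `RS` of the (signed) plus-symbol measure with the Mazur–Tate–Teitelbaum truncation
inequality at index `n + e`, and `‖ϖ·RS (n+e) n₀‖_p = 1`).

HONEST FRAMING. THEOREMS ONLY — no definition, no new named fact; nothing about any particular curve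
is asserted (the Riemann-sum datum and the integers are hypotheses an instrument's exact symbol table
is EVIDENCE for); closes nothing; moves no label. What this file makes explicit: for the line
`mudescent` AT A PAIR, the whole analytic side (stub 3's `X2.AnalyticMuLE W₀ p 0` and stub 4's
`X2.AnalyticLambdaEq W₀ p n` with its value) is ONE finite modular-symbol computation, and with
lam-b's integer data the main conjecture at a type-A split étale end is kernel-checked modulo the
named print `hWu` (Wuthrich 2014 Thm. 16), `hPT` (Poitou–Tate), `h415` (Greenberg Prop. 4.15 (ii)),
`hpar` (modularity).

* `analyticMuLE_zero_and_exists_analyticLambdaEq_of_riemannSumUnitCertAt` — datum ⇒ typed inputs;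
* `mazurMainConjectureAt_of_riemannSumUnitCertAt_of_algebraicLambdaGE` — + `AlgebraicLambdaGE W₀ p k`,
  `n ≤ k` ⇒ MC at the pair;
* `X2.mazurMainConjectureAt_of_riemannSumUnitCertAt_of_dvd_torsionOrder_of_dvd_localTamagawaNumber` —
  END-TO-END at a type-A split étale end: datum at index `n + 1` + `p ∣ #E(ℚ)_tors` + `S` Tamagawa
  places + `n + 2·v_p(#E(ℚ)_tors) ≤ #S + 1` ⇒ `X2.MazurMainConjectureAt W₀ p`;
* `…_of_layerRankGEAt` — the rank-growth road from the datum.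
* §2 (appended) the OTHER instrument currency — ONE BIRCH SUM `|ϖ·∑_a χ(a)[a/p^{n+1+e₀}]⁺_f|^{φ(pⁿ⁺¹)}
  = p^{−V}`, `V < φ(pⁿ⁺¹)` (one twisted special value of the layer `n + 1`; the integral model comes
  from Wuthrich Thm. 16 via g0's `exists_data`): ⇒ `X2.AnalyticMuLE W p 0 ∧ X2.AnalyticLambdaEq W p V`
  (`…_of_norm_twist_pow_eq_of_red`) ⇒ MC at the pair given `AlgebraicLambdaGE W p k`, `V ≤ k + e`
  ⇒ END-TO-END at a type-A split étale end with `V + 2·v_p(#E(ℚ)_tors) ≤ #S + 2`.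

References: [MazurTateTeitelbaum1986Invent] §I.10–I.15; [SteinWuthrich2013] §3, §4.2, §11 remark;
[GreenbergLNM1716] §5 pp. 114–118, Cor. 5.6 (p. 136), Thm. 1.9; [Wuthrich2014] Thm. 16.
-/

set_option linter.dupNamespace false
set_option autoImplicit false

noncomputable section

open scoped Classical MatrixGroups ModularForm

open PowerSeries CongruenceSubgroup WeierstrassCurve NumberField IsDedekindDomain
  Literature.NumberTheory.EllipticCurves
  Literature.NumberTheory.EllipticCurves.ModularForms
  Literature.NumberTheory.EllipticCurves.Rank1Residual
  Literature.NumberTheory.EllipticCurves.Greenberg1999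
  Literature.NumberTheory.EllipticCurves.Wuthrich2014
  Literature.NumberTheory.GaloisCohomology
  Summit.BirchSwinnertonDyer.Rank1Residual
  Summit.BirchSwinnertonDyer.Rank1Residual.X1.TamagawaSqueeze
  Summit.BirchSwinnertonDyer.Rank1Residual.Iwasawa
  Summit.BirchSwinnertonDyer.BirchSwinnertonDyer.Theorems.EisensteinPrimesX2AnalyticLambdaCertificate
  Summit.BirchSwinnertonDyer.BirchSwinnertonDyer.Theorems.EisensteinPrimesX2LambdaCountAtPair

namespace Summit.BirchSwinnertonDyer.BirchSwinnertonDyer.Theorems.EisensteinPrimesX2LambdaCountFromRiemannSums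

variable {W : WeierstrassCurve ℚ} [W.IsElliptic] [W.IsGloballyMinimal] {p : ℕ} [hp : Fact p.Prime]

/-- **The instrument datum gives the analytic inputs of stubs 3 + 4 at the pair**: at a multiplicative
prime, `RiemannSumUnitCertAt W p n` ⇒ `X2.AnalyticMuLE W p 0 ∧ ∃ m, X2.AnalyticLambdaEq W p m ∧
(¬split → m ≤ n) ∧ (split → m ≤ n + 1)` (iw-1's `unitCoeffAt_of_riemannSumUnitCertAt` + this seat's
`analyticMuLE_zero_and_exists_analyticLambdaEq_of_unitCoeffAt`).
[cite: MazurTateTeitelbaum1986Invent, §I.10 Prop. and §I.11–I.15] [cite: SteinWuthrich2013, §3 and §4.2] -/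
theorem analyticMuLE_zero_and_exists_analyticLambdaEq_of_riemannSumUnitCertAt
    (hmult : W.HasMultiplicativeReductionAtPrime p) {n : ℕ} (h : RiemannSumUnitCertAt W p n) :
    X2.AnalyticMuLE W p 0 ∧ ∃ m : ℕ, X2.AnalyticLambdaEq W p m ∧
      (¬ W.HasSplitMultiplicativeReductionAtPrime p → m ≤ n) ∧
      (W.HasSplitMultiplicativeReductionAtPrime p → m ≤ n + 1) :=
  analyticMuLE_zero_and_exists_analyticLambdaEq_of_unitCoeffAt
    (unitCoeffAt_of_riemannSumUnitCertAt hmult h)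

/-- **Mazur's main conjecture at a reducible odd multiplicative pair from the instrument datum and an
algebraic budget**: `RiemannSumUnitCertAt W p n`, `AlgebraicLambdaGE W p k`, `n ≤ k` ⇒
`X2.MazurMainConjectureAt W p` (route T, Wuthrich Thm. 16 `hWu`). [cite: Wuthrich2014, Thm. 16 (p. 397)]
[cite: GreenbergLNM1716, Cor. 5.6 (p. 136)] -/
theorem mazurMainConjectureAt_of_riemannSumUnitCertAt_of_algebraicLambdaGE
    (hWu : thm16_charIdeal_dvd_multiplicative_of_reducible) (hp2 : p ≠ 2)
    (hmult : W.HasMultiplicativeReductionAtPrime p) (hred : ¬ W.HasIrreducibleModPGaloisRep p)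
    {n k : ℕ} (h : RiemannSumUnitCertAt W p n) (halg : AlgebraicLambdaGE W p k) (hnk : n ≤ k) :
    X2.MazurMainConjectureAt W p :=
  mazurMainConjectureAt_of_unitCoeffAt_of_algebraicLambdaGE hWu hp2 hmult hred
    (unitCoeffAt_of_riemannSumUnitCertAt hmult h) halg hnk

/-- **The rank-growth road from the instrument datum** (reducible pair): `RiemannSumUnitCertAt W p n`,
`LayerRankGEAt W p k m` (`rank E(ℚ_k) ≥ m`), `n ≤ m` ⇒ `X2.MazurMainConjectureAt W p`.
[cite: GreenbergLNM1716, Thm. 1.9 (p. 63)] [cite: Wuthrich2014, Thm. 16 (p. 397)] -/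
theorem mazurMainConjectureAt_of_riemannSumUnitCertAt_of_layerRankGEAt
    (hWu : thm16_charIdeal_dvd_multiplicative_of_reducible) (hp2 : p ≠ 2)
    (hmult : W.HasMultiplicativeReductionAtPrime p) (hred : ¬ W.HasIrreducibleModPGaloisRep p)
    {n k m : ℕ} (h : RiemannSumUnitCertAt W p n) (hm : LayerRankGEAt W p k m) (hnm : n ≤ m) :
    X2.MazurMainConjectureAt W p :=
  mazurMainConjectureAt_of_unitCoeffAt_of_layerRankGEAt hWu hp2 hmult hred
    (unitCoeffAt_of_riemannSumUnitCertAt hmult h) hm hnm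

/-- **END-TO-END at a type-A SPLIT ÉTALE END from the instrument datum**: `p` odd multiplicative,
`p ∣ #E(ℚ)_tors(W₀)` (so split, `E[p]` reducible), `S` places `v ∤ p` with `p ∣ c_v(W₀)`, the datum
`RiemannSumUnitCertAt W₀ p n` (ONE certified Riemann sum at index `n + 1`), and
`n + 2·v_p(#E(ℚ)_tors) ≤ #S + 1` ⇒ `X2.MazurMainConjectureAt W₀ p`. Named print: `hWu`, `hPT`, `h415`,
`hpar`; everything else is integers and one exact modular-symbol table.
[cite: GreenbergLNM1716, §5 pp. 114–118 and Cor. 5.6 (p. 136)] [cite: Wuthrich2014, Thm. 16 (p. 397)]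
[cite: MazurTateTeitelbaum1986Invent, §I.10 Prop. and §I.14] -/
theorem X2.mazurMainConjectureAt_of_riemannSumUnitCertAt_of_dvd_torsionOrder_of_dvd_localTamagawaNumber
    (hodd : p ≠ 2) (hPT : poitouTate_selmerStructure_duality ℚ)
    (h415 : prop415ii_noFiniteSubmodule_of_ordinary_or_multiplicative)
    (hWu : thm16_charIdeal_dvd_multiplicative_of_reducible)
    (hpar : nonempty_modularParametrizationData)
    (hmult : W.HasMultiplicativeReductionAtPrime p) (htors : p ∣ W.torsionOrder)
    (S : Finset (HeightOneSpectrum (𝓞 ℚ))) (hSp : ∀ v ∈ S, ((p : ℕ) : 𝓞 ℚ) ∉ v.asIdeal)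
    (hcv : ∀ v ∈ S,
      p ∣ (W.baseChange (v.adicCompletion ℚ)).localTamagawaNumber (v.adicCompletionIntegers ℚ))
    {n : ℕ} (h : RiemannSumUnitCertAt W p n)
    (hb : n + 2 * (W.torsionOrder).factorization p ≤ S.card + 1) :
    X2.MazurMainConjectureAt W p :=
  X2.mazurMainConjectureAt_of_unitCoeffAt_of_dvd_torsionOrder_of_dvd_localTamagawaNumber hodd hPT h415
    hWu hpar hmult htors S hSp hcv (unitCoeffAt_of_riemannSumUnitCertAt hmult h) hb

/-- **Slack form from the instrument datum** (`n + 2·v_p(#E(ℚ)_tors) ≤ #S + 2`, analytic rank `≤ 1`,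
`h310` + `hGZK`). [cite: GreenbergLNM1716, Prop. 3.10 and Cor. 5.6 (p. 136)] [cite: Wuthrich2014, Thm. 16 (p. 397)] -/
theorem X2.mazurMainConjectureAt_of_riemannSumUnitCertAt_of_dvd_torsionOrder_of_dvd_localTamagawaNumber_slack
    (hodd : p ≠ 2) (hPT : poitouTate_selmerStructure_duality ℚ)
    (h415 : prop415ii_noFiniteSubmodule_of_ordinary_or_multiplicative)
    (hWu : thm16_charIdeal_dvd_multiplicative_of_reducible)
    (h310 : prop310_selmerCorank_mod_two_eq_lambdaInvariant)
    (hGZK : rank_eq_analyticRank_of_analyticRank_le_one)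
    (hpar : nonempty_modularParametrizationData)
    (hmult : W.HasMultiplicativeReductionAtPrime p) (htors : p ∣ W.torsionOrder)
    (hr : W.analyticRank ≤ 1)
    (S : Finset (HeightOneSpectrum (𝓞 ℚ))) (hSp : ∀ v ∈ S, ((p : ℕ) : 𝓞 ℚ) ∉ v.asIdeal)
    (hcv : ∀ v ∈ S,
      p ∣ (W.baseChange (v.adicCompletion ℚ)).localTamagawaNumber (v.adicCompletionIntegers ℚ))
    {n : ℕ} (h : RiemannSumUnitCertAt W p n)
    (hb : n + 2 * (W.torsionOrder).factorization p ≤ S.card + 2) :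
    X2.MazurMainConjectureAt W p :=
  X2.mazurMainConjectureAt_of_unitCoeffAt_of_dvd_torsionOrder_of_dvd_localTamagawaNumber_slack hodd hPT
    h415 hWu h310 hGZK hpar hmult htors hr S hSp hcv (unitCoeffAt_of_riemannSumUnitCertAt hmult h) hb

/-! ## §2. From ONE Birch sum (a twisted special value of the layer `n + 1`) -/

section BirchSum

variable {N : ℕ} [NeZero N] {f : CuspForm (Gamma0 N) 2} {ϖ : ℚ} {L : PowerSeries ℚ_[p]}

/-- **ONE BIRCH SUM ⇒ the analytic inputs of stubs 3 + 4 at a reducible multiplicative odd pair**, the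
integral model being SUPPLIED by Wuthrich 2014 Thm. 16 (`hWu`) and modularity (`hpar`) through g0's
`exists_data` and this seat's `datum_unique` (all admissible data coincide): for THE datum `(f, ϖ, L)`
and ONE primitive even `p`-power-order `χ` of conductor `p^{n+1+e₀}` with
`|ϖ·∑_a χ(a)[a/p^{n+1+e₀}]⁺_f|^{φ(pⁿ⁺¹)} = p^{−V}`, `V < φ(pⁿ⁺¹)`: `X2.AnalyticMuLE W p 0 ∧
X2.AnalyticLambdaEq W p V`. [cite: Wuthrich2014, Thm. 16 (p. 397)] [cite: MazurTateTeitelbaum1986Invent, §I.13–I.14]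
[cite: Washington1997, §7.1–7.2 and Thm. 7.3] -/
theorem analyticMuLE_zero_and_analyticLambdaEq_of_norm_twist_pow_eq_of_red
    (hWu : thm16_charIdeal_dvd_multiplicative_of_reducible) (hpar : nonempty_modularParametrizationData)
    (hp2 : p ≠ 2) (hmult : W.HasMultiplicativeReductionAtPrime p)
    (hred : ¬ W.HasIrreducibleModPGaloisRep p) (hf : IsNewformOf W f)
    (hϖ : (ϖ : ℝ) * W.realPeriodRat = plusPeriod f)
    (hLs : W.HasSplitMultiplicativeReductionAtPrime p → IsSplitMultPAdicLFunctionOf f p L)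
    (hLn : ¬ W.HasSplitMultiplicativeReductionAtPrime p → IsMultPAdicLFunctionOf f p (-1) L)
    {n : ℕ} (χ : DirichletCharacter ℂ_[p] (p ^ (n + 1 + cyclotomicExponent p)))
    (hχ : χ.IsPrimitive) (heven : χ.Even) (hord : ∃ j : ℕ, orderOf χ = p ^ j) {V : ℕ}
    (hV : V < Nat.totient (p ^ (n + 1)))
    (h : ‖algebraMap ℚ_[p] ℂ_[p] ((ϖ : ℚ) : ℚ_[p]) * ratTwistedSymbolSum f χ‖ ^
      Nat.totient (p ^ (n + 1)) = ((p : ℝ)⁻¹) ^ V) :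
    X2.AnalyticMuLE W p 0 ∧ X2.AnalyticLambdaEq W p V := by
  obtain ⟨N', _, f', ϖ', L', G, hf', hϖ', hLs', hLn', hG⟩ :=
    EisensteinPrimesAnalyticLambdaCalculus.exists_data hWu hpar hp2 hmult hred
  obtain ⟨rfl, rfl⟩ := datum_unique hf hϖ hLs hLn hf' hϖ' hLs' hLn'
  exact analyticMuLE_zero_and_analyticLambdaEq_of_norm_twist_pow_eq hf hϖ hLs hLn hG χ hχ heven hord
    hV h

/-- **Mazur's main conjecture at the pair from ONE Birch sum and an algebraic budget**: as above, plus
`AlgebraicLambdaGE W p k` with `V ≤ k` (non-split) / `V ≤ k + 1` (split) ⇒ `X2.MazurMainConjectureAt W p`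
(route T). [cite: Wuthrich2014, Thm. 16 (p. 397)] [cite: GreenbergLNM1716, Cor. 5.6 (p. 136)] -/
theorem mazurMainConjectureAt_of_norm_twist_pow_eq_of_algebraicLambdaGE
    (hWu : thm16_charIdeal_dvd_multiplicative_of_reducible) (hpar : nonempty_modularParametrizationData)
    (hp2 : p ≠ 2) (hmult : W.HasMultiplicativeReductionAtPrime p)
    (hred : ¬ W.HasIrreducibleModPGaloisRep p) (hf : IsNewformOf W f)
    (hϖ : (ϖ : ℝ) * W.realPeriodRat = plusPeriod f)
    (hLs : W.HasSplitMultiplicativeReductionAtPrime p → IsSplitMultPAdicLFunctionOf f p L)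
    (hLn : ¬ W.HasSplitMultiplicativeReductionAtPrime p → IsMultPAdicLFunctionOf f p (-1) L)
    {n : ℕ} (χ : DirichletCharacter ℂ_[p] (p ^ (n + 1 + cyclotomicExponent p)))
    (hχ : χ.IsPrimitive) (heven : χ.Even) (hord : ∃ j : ℕ, orderOf χ = p ^ j) {V : ℕ}
    (hV : V < Nat.totient (p ^ (n + 1)))
    (h : ‖algebraMap ℚ_[p] ℂ_[p] ((ϖ : ℚ) : ℚ_[p]) * ratTwistedSymbolSum f χ‖ ^
      Nat.totient (p ^ (n + 1)) = ((p : ℝ)⁻¹) ^ V)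
    {k : ℕ} (halg : AlgebraicLambdaGE W p k)
    (hkN : ¬ W.HasSplitMultiplicativeReductionAtPrime p → V ≤ k)
    (hkS : W.HasSplitMultiplicativeReductionAtPrime p → V ≤ k + 1) : X2.MazurMainConjectureAt W p := by
  obtain ⟨hμ, hlam⟩ := analyticMuLE_zero_and_analyticLambdaEq_of_norm_twist_pow_eq_of_red hWu hpar hp2
    hmult hred hf hϖ hLs hLn χ hχ heven hord hV h
  exact X2.mazurMainConjectureAt_of_algebraicLambdaGE hWu W p hp2 hmult hred hμ hlam halg hkN hkS

/-- **END-TO-END at a type-A SPLIT ÉTALE END from ONE Birch sum**: `p` odd multiplicative,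
`p ∣ #E(ℚ)_tors(W₀)`, `S` places `v ∤ p` with `p ∣ c_v(W₀)`, one Birch sum of conductor `p^{n+1+e₀}`
with `|ϖ·Birch(χ)|^{φ(pⁿ⁺¹)} = p^{−V}`, `V < φ(pⁿ⁺¹)`, and `V + 2·v_p(#E(ℚ)_tors) ≤ #S + 2` ⇒
`X2.MazurMainConjectureAt W₀ p` (λ_an = V exactly, so the trivial zero gives `k = V − 1`; lam-b
p480562 supplies `AlgebraicLambdaGE W₀ p (V − 1)`). Named print: `hWu`, `hPT`, `h415`, `hpar`.
[cite: GreenbergLNM1716, §5 pp. 114–118 and Cor. 5.6 (p. 136)] [cite: Wuthrich2014, Thm. 16 (p. 397)]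
[cite: MazurTateTeitelbaum1986Invent, §I.13–I.15] -/
theorem X2.mazurMainConjectureAt_of_norm_twist_pow_eq_of_dvd_torsionOrder_of_dvd_localTamagawaNumber
    (hodd : p ≠ 2) (hPT : poitouTate_selmerStructure_duality ℚ)
    (h415 : prop415ii_noFiniteSubmodule_of_ordinary_or_multiplicative)
    (hWu : thm16_charIdeal_dvd_multiplicative_of_reducible)
    (hpar : nonempty_modularParametrizationData)
    (hmult : W.HasMultiplicativeReductionAtPrime p) (htors : p ∣ W.torsionOrder)
    (S : Finset (HeightOneSpectrum (𝓞 ℚ))) (hSp : ∀ v ∈ S, ((p : ℕ) : 𝓞 ℚ) ∉ v.asIdeal)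
    (hcv : ∀ v ∈ S,
      p ∣ (W.baseChange (v.adicCompletion ℚ)).localTamagawaNumber (v.adicCompletionIntegers ℚ))
    (hf : IsNewformOf W f) (hϖ : (ϖ : ℝ) * W.realPeriodRat = plusPeriod f)
    (hLs : W.HasSplitMultiplicativeReductionAtPrime p → IsSplitMultPAdicLFunctionOf f p L)
    (hLn : ¬ W.HasSplitMultiplicativeReductionAtPrime p → IsMultPAdicLFunctionOf f p (-1) L)
    {n : ℕ} (χ : DirichletCharacter ℂ_[p] (p ^ (n + 1 + cyclotomicExponent p)))
    (hχ : χ.IsPrimitive) (heven : χ.Even) (hord : ∃ j : ℕ, orderOf χ = p ^ j) {V : ℕ}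
    (hV : V < Nat.totient (p ^ (n + 1)))
    (h : ‖algebraMap ℚ_[p] ℂ_[p] ((ϖ : ℚ) : ℚ_[p]) * ratTwistedSymbolSum f χ‖ ^
      Nat.totient (p ^ (n + 1)) = ((p : ℝ)⁻¹) ^ V)
    (hb : V + 2 * (W.torsionOrder).factorization p ≤ S.card + 2) :
    X2.MazurMainConjectureAt W p := by
  have hred : ¬ W.HasIrreducibleModPGaloisRep p :=
    not_hasIrreducibleModPGaloisRep_of_dvd_torsionOrder W p htors
  have hp3 : 3 ≤ p := by
    have h2 := hp.out.two_le
    omega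
  have hsplit : W.HasSplitMultiplicativeReductionAtPrime p :=
    X2.hasSplitMultiplicativeReductionAtPrime_of_dvd_torsionOrder W p hp3 hmult htors
  obtain ⟨hμ, hlam⟩ := analyticMuLE_zero_and_analyticLambdaEq_of_norm_twist_pow_eq_of_red hWu hpar hodd
    hmult hred hf hϖ hLs hLn χ hχ heven hord hV h
  rcases Nat.eq_zero_or_pos V with rfl | hVpos
  · exact X2.mazurMainConjectureAt_of_algebraicLambdaGE hWu W p hodd hmult hred hμ hlam
      (algebraicLambdaGE_zero W p) (fun _ ↦ le_rfl) (fun _ ↦ Nat.zero_le _)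
  · have hb' : (V - 1) + 2 * (W.torsionOrder).factorization p ≤ S.card + 1 := by omega
    have halg : AlgebraicLambdaGE W p (V - 1 - 0) :=
      EisensteinPrimesX2AlgebraicLambdaGESplitTorsion.X2.algebraicLambdaGE_of_dvd_torsionOrder_of_dvd_localTamagawaNumber
        hodd hPT h415 hWu hpar hmult htors S hSp hcv hμ hb'
    exact X2.mazurMainConjectureAt_of_algebraicLambdaGE hWu W p hodd hmult hred hμ hlam halg
      (fun hns ↦ absurd hsplit hns) (fun _ ↦ by omega)

end BirchSum

end Summit.BirchSwinnertonDyer.BirchSwinnertonDyer.Theorems.EisensteinPrimesX2LambdaCountFromRiemannSums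

end
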